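import Mathlib
import Summits.NavierStokesRegularity.NavierStokesRegularity.Theorems.ThreadingFluxPrecessionConicalEulerRigidity
import Summits.NavierStokesRegularity.NavierStokesRegularity.Theorems.ThreadingFluxHorizonTowerDefs
import Summits.NavierStokesRegularity.NavierStokesRegularity.Theorems.ThreadingFluxCentreJetDefs
import HarnessLib

/-!
# Crux `PoloidalLiouville` (stmt-NavierStokesRegularity-1222, W1), crux idea «precession-gap» (ns-idea-15), §steady:
# STEADY HORIZON RIGIDITY — every homogeneous `C²` blow-down limit of a steady unthreaded classical flow is CONSTANT
# ((J′), eng-4's corollary of the sketch item (J) `ConicalSteadyEulerRigidity`)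

Support file (`--supports stmt-NavierStokesRegularity-1222`, helper).  Experiment cell `ns-wall-extremal`, width hand
ns-wall-eng-4 g4.  0 kit.  Not a sketch `Prop`: a NEW statement in the vocabulary of the tree's Theorems-side twins
(`CentreJet.IsSteadyNSOn`, `CentreJet.IsUnthreadedAbout` of `ThreadingFluxCentreJetDefs`; `HorizonTower.IsBlowdownLimit`,
`HorizonTower.IsZeroHomogeneousAbout` of `ThreadingFluxHorizonTowerDefs`), composing (J) with the blow-down bookkeeping of the
horizon card (`OrderTwoHorizonLawBlowdown` / `HorizonSieve` use the same `IsBlowdownLimit`).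

## Statement (`Precession.steadyHorizonRigidity`)

Let `(V, p)` be a classical steady Navier–Stokes flow on `ℝ³` (`V ∈ C³`, `p ∈ C¹`, `div V = 0`, `(V·∇)V + ∇p = ΔV`), unthreaded
about `x₀` (`⟪x − x₀, curl V x⟫ = 0` for all `x`).  Suppose a blow-down sequence `y ↦ V (x₀ + λₖ y)`, `λₖ → ∞`, has a limit
`(U, P₀)` in the sense of `HorizonTower.IsBlowdownLimit V p x₀ U P₀` — six derivatives of `V (x₀ + λₖ ·) − U` and two of
`p (x₀ + λₖ ·) − cₖ − P₀` tend to `0` uniformly on compact subsets of `ℝ³ ∖ {0}` — with `U`, `P₀` of class `C²` and degree-0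
homogeneous off the origin (LOG-FREE pressure: no `s₀ log r` term).  Then `U` is CONSTANT off the origin.

READING.  The horizon card's sieve says: homogeneous blow-downs of general unthreaded slices satisfy `𝔏₁[U] = 𝔏₂[U] = 0`.  On the
STEADY stratum (the residual core `SteadyPoloidalLiouville(W1)` of the precession card) the conclusion is the strongest possible:
the only homogeneous `C²` horizons with log-free pressure are constants.  (Boundedness of `V` is not even used; the hypothesis is
the EXISTENCE of the homogeneous limit.)  Information-grade: it constrains hypothetical counterexamples, proves no Liouville
theorem; `SteadyPoloidalLiouville`, `PoloidalLiouville` (1222) and NS regularity stay OPEN.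

## Proof

Fix `z ≠ 0` and test the convergence on the compact `{z}`: with `Vₖ y := V (x₀ + λₖ y)`, `pₖ y := p (x₀ + λₖ y) − cₖ` one gets
`Vₖ z → U z`, `DVₖ(z) → DU(z)`, `∇pₖ(z) → ∇P₀(z)` and `ΔVₖ(z) → ΔU(z)` (orders 0, 1, 2 of the iterated derivatives; the
Laplacian is read through the standard frame).  The chain rule gives `DVₖ(z) = λₖ DV(xₖ)`, `ΔVₖ(z) = λₖ² ΔV(xₖ)`, `∇pₖ(z) =
λₖ ∇p(xₖ)` at `xₖ = x₀ + λₖ z`, so the steady equation at `xₖ`, multiplied by `λₖ`, reads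
`DVₖ(z)[Vₖ z] + ∇pₖ(z) = λₖ⁻¹ ΔVₖ(z)`; letting `k → ∞`: `DU(z)[U z] + ∇P₀(z) = 0` (steady EULER off the origin).  Likewise
`div Vₖ(z) = λₖ div V(xₖ) = 0 → div U(z)` and `⟪z, curl Vₖ z⟫ = ⟪xₖ − x₀, curl V xₖ⟫ = 0 → ⟪z, curl U z⟫`.  Now (J) in its `C²`
form, `Precession.conicalSteadyEulerRigidity_of_contDiffOn` (`ThreadingFluxPrecessionConicalEulerRigidity`), applies.

## References
* planner ns-idea-15, `Cruxes/PoloidalLiouville/Ideas/precession-gap.md` §steady (the steady-horizon remark), `…/PrecessionSketch.lean`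
  l.235 (J); `Cruxes/PoloidalLiouville/HorizonTowerSketch.lean` (`IsBlowdownLimit`, `HorizonSieve`).
* A. J. Majda, A. L. Bertozzi, *Vorticity and Incompressible Flow* (CUP 2002), §1.1, §2.4.1. [MajdaBertozziCUP2002]
-/

-- the summit and its single problem share the name (D-0017 nested layout)
set_option linter.dupNamespace false

noncomputable section

namespace Summit.NavierStokesRegularity.NavierStokesRegularity.Theorems.PoloidalLiouville.Precession

open Set Function Filter Topology Metric
open scoped Topology RealInnerProductSpace Laplacian ContDiff
open Literature.Analysis.FluidPDE
open Summit.NavierStokesRegularity.NavierStokesRegularity.Theorems.PoloidalLiouville.HorizonTower (E3)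

/-- **(J′) STEADY HORIZON RIGIDITY.**  Let `(V, p)` be a classical steady Navier–Stokes flow on `ℝ³`
(`CentreJet.IsSteadyNSOn univ V p`) that is unthreaded about `x₀` (`CentreJet.IsUnthreadedAbout x₀ V`).  If a blow-down sequence
`y ↦ V (x₀ + λₖ y)`, `λₖ → ∞`, has a limit `(U, P₀)` in the sense of `HorizonTower.IsBlowdownLimit` (six derivatives for `V`, two
for `p` modulo constants, uniformly on compacts off `0`) with `U`, `P₀` of class `C²` and degree-0 homogeneous off the origin
(log-free pressure), then the horizon profile `U` is CONSTANT off the origin: the rescaled equation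
`(Uₖ·∇)Uₖ + ∇Pₖ = λₖ⁻¹ ΔUₖ` passes to the limit pointwise off `0` (steady EULER for `(U, P₀)`), `div` and the threading density
`⟪y, curl ·⟫` pass to the limit, and (J) in its `C²` form `conicalSteadyEulerRigidity_of_contDiffOn` applies. -/
theorem steadyHorizonRigidity (V : E3 → E3) (p : E3 → ℝ) (x₀ : E3) (U : E3 → E3) (P₀ : E3 → ℝ)
    (hNS : CentreJet.IsSteadyNSOn Set.univ V p) (hun : CentreJet.IsUnthreadedAbout x₀ V)
    (hU : ContDiffOn ℝ 2 U {0}ᶜ) (hP : ContDiffOn ℝ 2 P₀ {0}ᶜ)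
    (hUhom : HorizonTower.IsZeroHomogeneousAbout 0 U) (hPhom : ∀ c : ℝ, 0 < c → ∀ y : E3, y ≠ 0 → P₀ (c • y) = P₀ y)
    (hbd : HorizonTower.IsBlowdownLimit V p x₀ U P₀) :
    ∃ a : E3, ∀ y, y ≠ 0 → U y = a := by
  obtain ⟨hVC, hpC, hdivV, hEqV⟩ := hNS
  obtain ⟨lam, c, hlam, hlimV, hlimP⟩ := hbd
  have hopen : IsOpen ({0}ᶜ : Set E3) := isOpen_compl_singleton
  have hV2 : ContDiff ℝ 2 V := (contDiffOn_univ.mp hVC).of_le (by norm_cast)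
  have hp1 : ContDiff ℝ 1 p := contDiffOn_univ.mp hpC
  have hVd : ∀ x, DifferentiableAt ℝ V x := fun x => hV2.differentiable (by norm_cast) x
  have hDVd : ∀ x, DifferentiableAt ℝ (fderiv ℝ V) x := fun x =>
    (hV2.fderiv_right (m := 1) (by norm_cast)).differentiable (by simp) x
  have hpd : ∀ x, DifferentiableAt ℝ p x := fun x => hp1.differentiable (by simp) x
  -- degree-0 homogeneity of `U` about the origin in the plain form
  have hUhom' : ∀ c : ℝ, 0 < c → ∀ y : E3, U (c • y) = U y := by
    intro c hc y; simpa using hUhom c hc y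
  -- the limit `λₖ → ∞`: eventually positive, `λₖ⁻¹ → 0`
  have hlam_pos : ∀ᶠ k in atTop, 0 < lam k := hlam.eventually_gt_atTop 0
  have hlam_inv : Tendsto (fun k => (lam k)⁻¹) atTop (𝓝 0) := tendsto_inv_atTop_zero.comp hlam
  /- the rescaled fields `Vₖ y = V (x₀ + λₖ y)`, `pₖ y = p (x₀ + λₖ y) − cₖ` and their derivatives -/
  set Vk : ℕ → E3 → E3 := fun k y => V (x₀ + lam k • y) with hVk
  set pk : ℕ → E3 → ℝ := fun k y => p (x₀ + lam k • y) - c k with hpk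
  have hA : ∀ (k : ℕ) (y : E3), HasFDerivAt (fun z : E3 => x₀ + lam k • z) (lam k • ContinuousLinearMap.id ℝ E3) y :=
    fun k y => ((hasFDerivAt_id y).const_smul (lam k)).const_add x₀
  have hDVk : ∀ (k : ℕ) (y : E3), HasFDerivAt (Vk k) (lam k • fderiv ℝ V (x₀ + lam k • y)) y := by
    intro k y
    have h := (hVd (x₀ + lam k • y)).hasFDerivAt.comp y (hA k y)
    have e : (fderiv ℝ V (x₀ + lam k • y)).comp (lam k • ContinuousLinearMap.id ℝ E3)
        = lam k • fderiv ℝ V (x₀ + lam k • y) := by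
      ext v; simp
    rw [e] at h
    exact h
  have hfVk : ∀ k, fderiv ℝ (Vk k) = fun y => lam k • fderiv ℝ V (x₀ + lam k • y) :=
    fun k => funext fun y => (hDVk k y).fderiv
  have hDDVk : ∀ (k : ℕ) (y : E3) (e e' : E3),
      fderiv ℝ (fderiv ℝ (Vk k)) y e e' = (lam k * lam k) • fderiv ℝ (fderiv ℝ V) (x₀ + lam k • y) e e' := by
    intro k y e e'
    have h1 : HasFDerivAt (fun z : E3 => fderiv ℝ V (x₀ + lam k • z))
        ((fderiv ℝ (fderiv ℝ V) (x₀ + lam k • y)).comp (lam k • ContinuousLinearMap.id ℝ E3)) y :=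
      (hDVd (x₀ + lam k • y)).hasFDerivAt.comp y (hA k y)
    have h2 : HasFDerivAt (fderiv ℝ (Vk k))
        (lam k • (fderiv ℝ (fderiv ℝ V) (x₀ + lam k • y)).comp (lam k • ContinuousLinearMap.id ℝ E3)) y := by
      rw [hfVk k]; exact h1.const_smul (lam k)
    rw [h2.fderiv]
    simp only [smul_apply, ContinuousLinearMap.comp_apply, ContinuousLinearMap.id_apply, map_smul, smul_smul]
  have hDpk : ∀ (k : ℕ) (y : E3), HasFDerivAt (pk k) (lam k • fderiv ℝ p (x₀ + lam k • y)) y := by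
    intro k y
    have h := ((hpd (x₀ + lam k • y)).hasFDerivAt.comp y (hA k y)).sub_const (c k)
    have e : (fderiv ℝ p (x₀ + lam k • y)).comp (lam k • ContinuousLinearMap.id ℝ E3)
        = lam k • fderiv ℝ p (x₀ + lam k • y) := by
      ext v; simp
    rw [e] at h
    exact h
  -- regularity of the rescaled fields
  have hAC : ∀ k, ContDiff ℝ 2 (fun y : E3 => x₀ + lam k • y) := fun k =>
    contDiff_const.add (contDiff_id.const_smul (lam k))
  have hVkC : ∀ k, ContDiff ℝ 2 (Vk k) := fun k => hV2.comp (hAC k)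
  /- pointwise limits at a fixed `z ≠ 0`, read off the blow-down convergence on the compact `{z}` -/
  have hptV : ∀ z : E3, z ≠ 0 → ∀ j ≤ 6,
      Tendsto (fun k => ‖iteratedFDeriv ℝ j (fun y : E3 => V (x₀ + lam k • y) - U y) z‖) atTop (𝓝 0) := by
    intro z hz j hj
    have h0 : (0 : E3) ∉ ({z} : Set E3) := by
      rw [Set.mem_singleton_iff]; exact fun h => hz h.symm
    have h := hlimV {z} isCompact_singleton h0 j hj
    simpa only [Set.image_singleton, csSup_singleton] using h
  have hptP : ∀ z : E3, z ≠ 0 → ∀ j ≤ 2,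
      Tendsto (fun k => ‖iteratedFDeriv ℝ j (fun y : E3 => p (x₀ + lam k • y) - c k - P₀ y) z‖) atTop (𝓝 0) := by
    intro z hz j hj
    have h0 : (0 : E3) ∉ ({z} : Set E3) := by
      rw [Set.mem_singleton_iff]; exact fun h => hz h.symm
    have h := hlimP {z} isCompact_singleton h0 j hj
    simpa only [Set.image_singleton, csSup_singleton] using h
  -- evaluation `(L, v) ↦ L v` is jointly continuous
  have happly : ∀ {L : ℕ → E3 →L[ℝ] E3} {v : ℕ → E3} {L₀ : E3 →L[ℝ] E3} {v₀ : E3},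
      Tendsto L atTop (𝓝 L₀) → Tendsto v atTop (𝓝 v₀) → Tendsto (fun k => L k (v k)) atTop (𝓝 (L₀ v₀)) := by
    intro L v L₀ v₀ hL hv
    have hc : Continuous fun q : (E3 →L[ℝ] E3) × E3 => q.1 q.2 := isBoundedBilinearMap_apply.continuous
    exact (hc.tendsto (L₀, v₀)).comp (hL.prodMk_nhds hv)
  -- the standard frame
  set e : OrthonormalBasis (Fin 3) ℝ E3 := EuclideanSpace.basisFun (Fin 3) ℝ with he
  have he1 : ∀ i, ‖e i‖ = 1 := fun i => e.orthonormal.1 i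
  /- the three limit statements at `z ≠ 0`: values, first derivatives, Laplacians -/
  have hL0 : ∀ z : E3, z ≠ 0 → Tendsto (fun k => Vk k z) atTop (𝓝 (U z)) := by
    intro z hz
    rw [tendsto_iff_norm_sub_tendsto_zero]
    have h := hptV z hz 0 (by norm_num)
    simpa only [norm_iteratedFDeriv_zero] using h
  have hL1 : ∀ z : E3, z ≠ 0 → Tendsto (fun k => fderiv ℝ (Vk k) z) atTop (𝓝 (fderiv ℝ U z)) := by
    intro z hz
    have hUd : DifferentiableAt ℝ U z := ((hU z hz).contDiffAt (hopen.mem_nhds hz)).differentiableAt (by norm_num)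
    rw [tendsto_iff_norm_sub_tendsto_zero]
    have h := hptV z hz 1 (by norm_num)
    refine h.congr fun k => ?_
    rw [← norm_iteratedFDeriv_fderiv, norm_iteratedFDeriv_zero,
      fderiv_fun_sub ((hDVk k z).differentiableAt) hUd]
  have hLP : ∀ z : E3, z ≠ 0 → Tendsto (fun k => gradient (pk k) z) atTop (𝓝 (gradient P₀ z)) := by
    intro z hz
    have hPd : DifferentiableAt ℝ P₀ z := ((hP z hz).contDiffAt (hopen.mem_nhds hz)).differentiableAt (by norm_num)
    rw [tendsto_iff_norm_sub_tendsto_zero]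
    have h := hptP z hz 1 (by norm_num)
    refine h.congr fun k => ?_
    rw [← norm_iteratedFDeriv_fderiv, norm_iteratedFDeriv_zero,
      fderiv_fun_sub ((hDpk k z).differentiableAt) hPd, gradient, gradient, ← map_sub, LinearIsometryEquiv.norm_map]
  -- Laplacians through the frame: `Δ f z = ∑ᵢ D²f(z)[eᵢ, eᵢ]`
  have hΔ : ∀ (f : E3 → E3) (z : E3), (Δ f) z = ∑ i, fderiv ℝ (fderiv ℝ f) z (e i) (e i) := by
    intro f z
    rw [InnerProductSpace.laplacian_eq_iteratedFDeriv_orthonormalBasis f e]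
    exact Finset.sum_congr rfl fun i _ => by rw [iteratedFDeriv_two_apply]; rfl
  have hL2 : ∀ z : E3, z ≠ 0 → Tendsto (fun k => (Δ (Vk k)) z) atTop (𝓝 ((Δ U) z)) := by
    intro z hz
    have hU2z : ContDiffAt ℝ 2 U z := (hU z hz).contDiffAt (hopen.mem_nhds hz)
    simp only [hΔ]
    refine tendsto_finsetSum _ fun i _ => ?_
    rw [tendsto_iff_norm_sub_tendsto_zero]
    have h := hptV z hz 2 (by norm_num)
    refine squeeze_zero (fun k => norm_nonneg _) (fun k => ?_) h
    have hsub : iteratedFDeriv ℝ 2 (fun y : E3 => V (x₀ + lam k • y) - U y) z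
        = iteratedFDeriv ℝ 2 (Vk k) z - iteratedFDeriv ℝ 2 U z := by
      have : (fun y : E3 => V (x₀ + lam k • y) - U y) = Vk k - U := rfl
      rw [this, iteratedFDeriv_sub_apply ((hVkC k).contDiffAt) hU2z]
    have happ : fderiv ℝ (fderiv ℝ (Vk k)) z (e i) (e i) - fderiv ℝ (fderiv ℝ U) z (e i) (e i)
        = (iteratedFDeriv ℝ 2 (fun y : E3 => V (x₀ + lam k • y) - U y) z) ![e i, e i] := by
      rw [hsub, sub_apply, iteratedFDeriv_two_apply, iteratedFDeriv_two_apply]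
      rfl
    rw [happ]
    calc ‖(iteratedFDeriv ℝ 2 (fun y : E3 => V (x₀ + lam k • y) - U y) z) ![e i, e i]‖
        ≤ ‖iteratedFDeriv ℝ 2 (fun y : E3 => V (x₀ + lam k • y) - U y) z‖ * ∏ j, ‖(![e i, e i] : Fin 2 → E3) j‖ :=
          ContinuousMultilinearMap.le_opNorm _ _
      _ = ‖iteratedFDeriv ℝ 2 (fun y : E3 => V (x₀ + lam k • y) - U y) z‖ := by
          rw [Fin.prod_univ_two]
          simp [he1]
  /- the rescaled steady equation `DVₖ(z)[Vₖ z] + ∇pₖ(z) = λₖ⁻¹ ΔVₖ(z)` and its limit -/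
  have hΔVk : ∀ (k : ℕ) (z : E3), (Δ (Vk k)) z = (lam k * lam k) • (Δ V) (x₀ + lam k • z) := by
    intro k z
    rw [hΔ, hΔ, Finset.smul_sum]
    exact Finset.sum_congr rfl fun i _ => hDDVk k z (e i) (e i)
  have hEqk : ∀ z : E3, ∀ᶠ k in atTop,
      fderiv ℝ (Vk k) z (Vk k z) + gradient (pk k) z = (lam k)⁻¹ • (Δ (Vk k)) z := by
    intro z
    filter_upwards [hlam_pos] with k hk
    have hx := hEqV (x₀ + lam k • z) (Set.mem_univ _)
    have hgrad : gradient (pk k) z = lam k • gradient p (x₀ + lam k • z) := by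
      rw [gradient, (hDpk k z).fderiv, map_smul, gradient]
    rw [(hDVk k z).fderiv, hgrad, hΔVk, smul_smul, inv_mul_cancel_left₀ hk.ne', smul_apply, ← smul_add]
    show lam k • ((fderiv ℝ V (x₀ + lam k • z)) (V (x₀ + lam k • z)) + gradient p (x₀ + lam k • z))
      = lam k • (Δ V) (x₀ + lam k • z)
    rw [hx]
  have hEulerU : ∀ z : E3, z ≠ 0 → fderiv ℝ U z (U z) + gradient P₀ z = 0 := by
    intro z hz
    have hlhs : Tendsto (fun k => fderiv ℝ (Vk k) z (Vk k z) + gradient (pk k) z) atTop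
        (𝓝 (fderiv ℝ U z (U z) + gradient P₀ z)) := (happly (hL1 z hz) (hL0 z hz)).add (hLP z hz)
    have hrhs : Tendsto (fun k => (lam k)⁻¹ • (Δ (Vk k)) z) atTop (𝓝 0) := by
      have h := hlam_inv.smul (hL2 z hz)
      rwa [zero_smul] at h
    exact tendsto_nhds_unique (hlhs.congr' (hEqk z)) hrhs
  /- the divergence and the threading density pass to the limit -/
  have hdivU : ∀ z : E3, z ≠ 0 → VectorCalculus.divergence U z = 0 := by
    intro z hz
    have hlim : Tendsto (fun k => VectorCalculus.divergence (Vk k) z) atTop (𝓝 (VectorCalculus.divergence U z)) := by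
      simp only [divergence_eq_sum_inner_fderiv e]
      exact tendsto_finsetSum _ fun i _ => tendsto_const_nhds.inner (happly (hL1 z hz) tendsto_const_nhds)
    have hzero : ∀ k, VectorCalculus.divergence (Vk k) z = 0 := by
      intro k
      rw [divergence_eq_sum_inner_fderiv e, (hDVk k z).fderiv]
      have h := hdivV (x₀ + lam k • z) (Set.mem_univ _)
      rw [divergence_eq_sum_inner_fderiv e] at h
      simp only [smul_apply, inner_smul_right, ← Finset.mul_sum, h, mul_zero]
    exact tendsto_nhds_unique hlim (tendsto_const_nhds.congr fun k => (hzero k).symm)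
  have hrotU : ∀ z : E3, z ≠ 0 → inner ℝ z (curl U z) = 0 := by
    intro z hz
    have hlim : Tendsto (fun k => inner ℝ z (curl (Vk k) z)) atTop (𝓝 (inner ℝ z (curl U z))) := by
      have hc : Tendsto (fun k => curl (Vk k) z) atTop (𝓝 (curl U z)) := by
        simp only [curl_eq_curlCLM]
        exact (curlCLM.continuous.tendsto _).comp (hL1 z hz)
      exact tendsto_const_nhds.inner hc
    have hzero : ∀ k, inner ℝ z (curl (Vk k) z) = 0 := by
      intro k
      rw [curl_eq_curlCLM, (hDVk k z).fderiv, map_smul, ← curl_eq_curlCLM, inner_smul_right, ← real_inner_smul_left]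
      have h := hun (x₀ + lam k • z)
      rwa [add_sub_cancel_left] at h
    exact tendsto_nhds_unique hlim (tendsto_const_nhds.congr fun k => (hzero k).symm)
  exact conicalSteadyEulerRigidity_of_contDiffOn U P₀ hU hP hUhom' hPhom hdivU hEulerU hrotU


end Summit.NavierStokesRegularity.NavierStokesRegularity.Theorems.PoloidalLiouville.Precession

end
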